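import Summits.MatrixMultiplication.MatrixMultiplication.Theorems.ObstructionDescentUniversalOccurrenceTwoRectangleFloor

set_option linter.dupNamespace false
set_option autoImplicit false

/-!
# Obstruction descent — the blow-up pairing at KERNEL level: joint pairing, the evaluation functional, and the
# duality transfer `(ν in the letters of X) = (ν in the third leg of t)` (decomp-mm · lens 3 · gen 47, def-free)

`route-MatrixMultiplication-ObstructionDescent`, SUPPORT for the crux `NoOccurrenceObstruction` (`P_O`, stmt 29040);
NODE-g47 §3, critic ruling lens-3 g47 (i)(a) «(T)-upper direction as a def-free theorem about `isotypicSum` of an evaluation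
functional».  Setting of parts F–XI (`…TwoRectangleDetInvariants` K25, `…Floor`, `…Storey`): a tensor `t` of cubic format
`N`, a width `δ`, a block structure `e : [Nδ] ≃ [δ] × [N]`, a letter tuple `X = (X_l)_{l<N}` of `δ × δ` matrices, and the
BLOW-UP DETERMINANT `D_X(t) = det(Σ_l X_l ⊗ T_l)`, `T_l = (t_{i j l})_{i,j}` (NODE-g45 §1: `F(X,t)`).

§1 `blowUp_det_eq_jointPairing` — LEIBNIZ = JOINT PAIRING.  Expanding `det` along `σ ∈ Sym([δ]×[N])` and the product of
   sums along a LETTER WORD `w : [Nδ] → [N]`,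
   `D_X(t) = Σ_σ sgn σ · Σ_w  X^{⊗Nδ}(w, α_σ, β) · t^{⊗Nδ}(u_σ, v, w)`,
   `α_σ = fst∘σ∘e`, `β = fst∘e`, `u_σ = snd∘σ∘e`, `v = snd∘e` (`kroneckerPow`): the SAME word `w` is the first (letter) leg of the
   tensor power of `X` (read as the 3-tensor `(l,a,b) ↦ (X_l)_{ab}`) and the third leg of the tensor power of `t` — the
   contraction of the letter index.  §1' `blowUp_det_eq_pairing_evalKernel`: regrouping, `D_X(t) = ⟪t^{⊗Nδ}, K_X⟫ =
   Σ_{u,v,w} t^{⊗Nδ}(u,v,w) K_X(u,v,w)` with the explicit EVALUATION KERNEL `K_X(u,v,w) = [v = snd∘e] Σ_{σ : snd∘σ∘e = u} sgn σ ·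
   X^{⊗Nδ}(w, fst∘σ∘e, fst∘e)` — the evaluation functional `t^{⊗Nδ} ↦ D_X(t)` as a vector of the word model, in the pairing
   currency of `isotypicSum₁₂₃_kroneckerPow_ne_zero_of_pairing_tripleHw_ne_zero`.
§2 `jointPairing_permLegs₁_eq_permLegs₃` — because the letter word is shared, permuting the letter legs of `X^{⊗Nδ}` by `π`
   inside the joint pairing is the same as permuting the third legs of `t^{⊗Nδ}` by `π⁻¹`.
§3 `jointPairing_isotypicSum₁_eq_isotypicSum₃` — THE TRANSFER (NODE-g45 §1 «(T) duality», kernel form): for every `ν ⊢ Nδ`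
   the `ν`-isotypic character sum taken in the LETTERS OF `X` (`isotypicSum₁ ν` on `X^{⊗Nδ}`) and the one taken in the THIRD LEG
   OF `t` (`isotypicSum₃ ν` on `t^{⊗Nδ}`) give the same value of the joint pairing («`(D_t)_ν(X) = (D_X)_ν(t)`»); equivalently
   (`…_eq_pairing_isotypicSum₃_evalKernel`) both equal `⟪t^{⊗Nδ}, isotypicSum₃ ν K_X⟫`, THE PAIRING OF THE TENSOR POWER WITH THE
   `ν`-ISOTYPIC SUM OF THE EVALUATION FUNCTIONAL (self-adjointness of the character sum, `pairing_isotypicSum₃_comm`).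
§4 `isotypicSum₃_kroneckerPow_ne_zero_of_letterIsotypic_ne_zero` — the cheap half of the upper direction: if the letter-`ν`
   part of `D_X(t)` is non-zero for one `X`, then `ν` occurs in the third-leg marginal of `t^{⊗Nδ}` (`isotypicSum₃ ν (t^{⊗Nδ}) ≠ 0`).
WHAT IS NOT HERE (NODE-g47 §3, the remaining debt, now scoped): the upgrade of §4 to the TRIPLE `((δ^N),(δ^N),ν)` —
`isotypicSum₁ (δ^N) (isotypicSum₂ (δ^N) (isotypicSum₃ ν (t^{⊗Nδ}))) ≠ 0` — needs the legs-1,2 selectivity of `K_X`, i.e. (L1)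
`D_X((A⊗B⊗1)t) = det A^δ det B^δ D_X(t)` (K25 `det_sum_kronecker_slice_actTensor₁₂`) turned into «the SYMMETRISED kernel is a
highest-weight vector of weight `((δ^N),(δ^N))` in legs 1,2» (polarisation: a symmetric kernel vanishing on all tensor powers
vanishes, tree `arrOf`/`sum_arrOf_mul_prod_X`), then `range_isotypicProj_wordPermRep` (the `ν`-isotypic component of the word
model is spanned by translates of highest-weight vectors) and `isotypicSum₁₂₃_kroneckerPow_ne_zero_of_pairing_ne_zero`.
No definition is introduced (`K_X` is spelled out); no `def`; sorry-free; §1–§2 over any commutative ring, §3–§4 over `ℂ`.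
Nothing here proves `ω = 2` or closes an item.
[cite: BurgisserIkenmeyer2011, §3.1, §10.1 (polarisation and the pairing)] [cite: ChristandlVranaZuiddam2023, §3.1 (the
character sums `P_λ`)] [cite: FultonHarrisGTM129, §15.3, Thm. 6.3]
-/

noncomputable section

open scoped BigOperators Kronecker

namespace Summit.MatrixMultiplication.MatrixMultiplication.Theorems.ObstructionDescentBlowUpDuality

open Literature.Computability.AlgebraicComplexity (kroneckerPow kroneckerPow_apply permLegs₁ permLegs₃ permLegs₁_apply
  permLegs₃_apply isotypicSum₁ isotypicSum₃ isotypicSum₁_def)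
open Literature.NumberTheory.DiophantineGeometry (spechtCharacter spechtCharacter_inv)

/-! ### §1 Leibniz = joint pairing; the evaluation kernel -/

section CommRing

variable {R : Type*} [CommRing R] {N δ : ℕ}

/-- One Leibniz term of `det(Σ_l X_l ⊗ T_l)`: the product over the positions `q ∈ [δ]×[N]` of the `(σ q, q)` entries is the sum
over letter words `w : [Nδ] → [N]` of `X^{⊗Nδ}(w, fst∘σ∘e, fst∘e) · t^{⊗Nδ}(snd∘σ∘e, snd∘e, w)`. [folklore] -/
theorem prod_kroneckerSum_slice_apply (e : Fin (N * δ) ≃ Fin δ × Fin N) (X : Fin N → Matrix (Fin δ) (Fin δ) R)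
    (t : Fin N → Fin N → Fin N → R) (σ : Equiv.Perm (Fin δ × Fin N)) :
    ∏ q, (∑ l, X l ⊗ₖ Matrix.of (fun i j => t i j l)) (σ q) q =
      ∑ w : Fin (N * δ) → Fin N,
        kroneckerPow (fun l a b => X l a b) (N * δ) w (fun k => (σ (e k)).1) (fun k => (e k).1) *
          kroneckerPow t (N * δ) (fun k => (σ (e k)).2) (fun k => (e k).2) w := by
  classical
  have h1 : ∏ q, (∑ l, X l ⊗ₖ Matrix.of (fun i j => t i j l)) (σ q) q =
      ∏ q, ∑ l, X l (σ q).1 q.1 * t (σ q).2 q.2 l := by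
    refine Finset.prod_congr rfl fun q _ => ?_
    simp [Matrix.sum_apply, Matrix.kroneckerMap_apply]
  rw [h1, Finset.prod_univ_sum]
  simp only [Fintype.piFinset_univ]
  rw [← Equiv.sum_comp (Equiv.arrowCongr e (Equiv.refl (Fin N)))]
  refine Finset.sum_congr rfl fun w _ => ?_
  rw [kroneckerPow_apply, kroneckerPow_apply, ← Finset.prod_mul_distrib, ← Equiv.prod_comp e]
  refine Finset.prod_congr rfl fun k _ => ?_
  simp [Equiv.arrowCongr_apply]

/-- **Leibniz = joint pairing.**  `D_X(t) = det(Σ_l X_l ⊗ T_l) = Σ_σ sgn σ · Σ_w X^{⊗Nδ}(w, fst∘σ∘e, fst∘e) · t^{⊗Nδ}(snd∘σ∘e, snd∘e, w)`: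
the letter word `w` is shared by the first leg of `X^{⊗Nδ}` and the third leg of `t^{⊗Nδ}`. [this node] -/
theorem blowUp_det_eq_jointPairing (e : Fin (N * δ) ≃ Fin δ × Fin N) (X : Fin N → Matrix (Fin δ) (Fin δ) R)
    (t : Fin N → Fin N → Fin N → R) :
    (∑ l, X l ⊗ₖ Matrix.of (fun i j => t i j l)).det =
      ∑ σ : Equiv.Perm (Fin δ × Fin N), ((Equiv.Perm.sign σ : ℤ) : R) *
        ∑ w : Fin (N * δ) → Fin N,
          kroneckerPow (fun l a b => X l a b) (N * δ) w (fun k => (σ (e k)).1) (fun k => (e k).1) *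
            kroneckerPow t (N * δ) (fun k => (σ (e k)).2) (fun k => (e k).2) w := by
  rw [Matrix.det_apply]
  refine Finset.sum_congr rfl fun σ _ => ?_
  rw [Units.smul_def, zsmul_eq_mul, prod_kroneckerSum_slice_apply e X t σ]

/-- **Regrouping the joint pairing by the `t`-side words.**  For any 3-leg array `T` on words,
`Σ_σ sgn σ Σ_w X^{⊗Nδ}(w,α_σ,β) T(u_σ,v,w) = Σ_{u,v,w} T(u,v,w) · K_X(u,v,w)` with the EVALUATION KERNEL
`K_X(u,v,w) = Σ_σ [snd∘σ∘e = u ∧ snd∘e = v] sgn σ · X^{⊗Nδ}(w, fst∘σ∘e, fst∘e)`. [this node] -/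
theorem jointPairing_eq_pairing_evalKernel (e : Fin (N * δ) ≃ Fin δ × Fin N) (X : Fin N → Matrix (Fin δ) (Fin δ) R)
    (T : (Fin (N * δ) → Fin N) → (Fin (N * δ) → Fin N) → (Fin (N * δ) → Fin N) → R) :
    (∑ σ : Equiv.Perm (Fin δ × Fin N), ((Equiv.Perm.sign σ : ℤ) : R) *
        ∑ w : Fin (N * δ) → Fin N,
          kroneckerPow (fun l a b => X l a b) (N * δ) w (fun k => (σ (e k)).1) (fun k => (e k).1) *
            T (fun k => (σ (e k)).2) (fun k => (e k).2) w) =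
      ∑ u : Fin (N * δ) → Fin N, ∑ v : Fin (N * δ) → Fin N, ∑ w : Fin (N * δ) → Fin N,
        T u v w *
          ∑ σ : Equiv.Perm (Fin δ × Fin N),
            (if (fun k => (σ (e k)).2) = u ∧ (fun k => (e k).2) = v then
              ((Equiv.Perm.sign σ : ℤ) : R) *
                kroneckerPow (fun l a b => X l a b) (N * δ) w (fun k => (σ (e k)).1) (fun k => (e k).1)
            else 0) := by
  classical
  symm
  calc (∑ u : Fin (N * δ) → Fin N, ∑ v : Fin (N * δ) → Fin N, ∑ w : Fin (N * δ) → Fin N,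
        T u v w *
          ∑ σ : Equiv.Perm (Fin δ × Fin N),
            (if (fun k => (σ (e k)).2) = u ∧ (fun k => (e k).2) = v then
              ((Equiv.Perm.sign σ : ℤ) : R) *
                kroneckerPow (fun l a b => X l a b) (N * δ) w (fun k => (σ (e k)).1) (fun k => (e k).1)
            else 0))
      = ∑ u : Fin (N * δ) → Fin N, ∑ v : Fin (N * δ) → Fin N, ∑ w : Fin (N * δ) → Fin N,
          ∑ σ : Equiv.Perm (Fin δ × Fin N),
            (if (fun k => (σ (e k)).2) = u ∧ (fun k => (e k).2) = v then
              ((Equiv.Perm.sign σ : ℤ) : R) *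
                (kroneckerPow (fun l a b => X l a b) (N * δ) w (fun k => (σ (e k)).1) (fun k => (e k).1) *
                  T u v w)
            else 0) := by
        refine Finset.sum_congr rfl fun u _ => Finset.sum_congr rfl fun v _ => Finset.sum_congr rfl fun w _ => ?_
        rw [Finset.mul_sum]
        refine Finset.sum_congr rfl fun σ _ => ?_
        split_ifs <;> ring
    _ = ∑ u : Fin (N * δ) → Fin N, ∑ v : Fin (N * δ) → Fin N, ∑ σ : Equiv.Perm (Fin δ × Fin N),
          ∑ w : Fin (N * δ) → Fin N,
            (if (fun k => (σ (e k)).2) = u ∧ (fun k => (e k).2) = v then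
              ((Equiv.Perm.sign σ : ℤ) : R) *
                (kroneckerPow (fun l a b => X l a b) (N * δ) w (fun k => (σ (e k)).1) (fun k => (e k).1) *
                  T u v w)
            else 0) :=
        Finset.sum_congr rfl fun u _ => Finset.sum_congr rfl fun v _ => Finset.sum_comm
    _ = ∑ u : Fin (N * δ) → Fin N, ∑ σ : Equiv.Perm (Fin δ × Fin N), ∑ v : Fin (N * δ) → Fin N,
          ∑ w : Fin (N * δ) → Fin N,
            (if (fun k => (σ (e k)).2) = u ∧ (fun k => (e k).2) = v then
              ((Equiv.Perm.sign σ : ℤ) : R) *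
                (kroneckerPow (fun l a b => X l a b) (N * δ) w (fun k => (σ (e k)).1) (fun k => (e k).1) *
                  T u v w)
            else 0) :=
        Finset.sum_congr rfl fun u _ => Finset.sum_comm
    _ = ∑ σ : Equiv.Perm (Fin δ × Fin N), ∑ u : Fin (N * δ) → Fin N, ∑ v : Fin (N * δ) → Fin N,
          ∑ w : Fin (N * δ) → Fin N,
            (if (fun k => (σ (e k)).2) = u ∧ (fun k => (e k).2) = v then
              ((Equiv.Perm.sign σ : ℤ) : R) *
                (kroneckerPow (fun l a b => X l a b) (N * δ) w (fun k => (σ (e k)).1) (fun k => (e k).1) *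
                  T u v w)
            else 0) := Finset.sum_comm
    _ = ∑ σ : Equiv.Perm (Fin δ × Fin N), ((Equiv.Perm.sign σ : ℤ) : R) *
          ∑ w : Fin (N * δ) → Fin N,
            kroneckerPow (fun l a b => X l a b) (N * δ) w (fun k => (σ (e k)).1) (fun k => (e k).1) *
              T (fun k => (σ (e k)).2) (fun k => (e k).2) w := by
        refine Finset.sum_congr rfl fun σ _ => ?_
        simp_rw [ite_and]
        rw [Finset.sum_eq_single (fun k => (σ (e k)).2)]
        · simp only [if_true]
          rw [Finset.sum_eq_single (fun k => (e k).2)]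
          · simp only [if_true, Finset.mul_sum]
          · intro v _ hv; simp [Ne.symm hv]
          · intro h; exact absurd (Finset.mem_univ _) h
        · intro u _ hu; simp [Ne.symm hu]
        · intro h; exact absurd (Finset.mem_univ _) h

/-- **The evaluation functional as a kernel.**  `D_X(t) = ⟪t^{⊗Nδ}, K_X⟫ = Σ_{u,v,w} t^{⊗Nδ}(u,v,w) · K_X(u,v,w)` with
`K_X(u,v,w) = Σ_σ [snd∘σ∘e = u ∧ snd∘e = v] sgn σ · X^{⊗Nδ}(w, fst∘σ∘e, fst∘e)`: the functional `t^{⊗Nδ} ↦ D_X(t)` is the vector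
`K_X` of the word model `(ℂ^N)^{⊗Nδ} ⊗ (ℂ^N)^{⊗Nδ} ⊗ (ℂ^N)^{⊗Nδ}`, in the pairing currency of the floor / storey laws. [this node] -/
theorem blowUp_det_eq_pairing_evalKernel (e : Fin (N * δ) ≃ Fin δ × Fin N) (X : Fin N → Matrix (Fin δ) (Fin δ) R)
    (t : Fin N → Fin N → Fin N → R) :
    (∑ l, X l ⊗ₖ Matrix.of (fun i j => t i j l)).det =
      ∑ u : Fin (N * δ) → Fin N, ∑ v : Fin (N * δ) → Fin N, ∑ w : Fin (N * δ) → Fin N,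
        kroneckerPow t (N * δ) u v w *
          ∑ σ : Equiv.Perm (Fin δ × Fin N),
            (if (fun k => (σ (e k)).2) = u ∧ (fun k => (e k).2) = v then
              ((Equiv.Perm.sign σ : ℤ) : R) *
                kroneckerPow (fun l a b => X l a b) (N * δ) w (fun k => (σ (e k)).1) (fun k => (e k).1)
            else 0) := by
  rw [blowUp_det_eq_jointPairing e X t, jointPairing_eq_pairing_evalKernel]

/-! ### §2 The shared letter word: `π` on the letter legs of `X^{⊗Nδ}` = `π⁻¹` on the third legs of `t^{⊗Nδ}` -/

/-- For ONE summand: `Σ_w (π ·₁ X^{⊗Nδ})(w,α,β) · t^{⊗Nδ}(u,v,w) = Σ_w X^{⊗Nδ}(w,α,β) · (π⁻¹ ·₃ t^{⊗Nδ})(u,v,w)` (reindex `w ↦ w∘π`).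
[this node] -/
theorem sum_permLegs₁_mul_eq_sum_mul_permLegs₃ (π : Equiv.Perm (Fin (N * δ)))
    (U : (Fin (N * δ) → Fin N) → (Fin (N * δ) → Fin δ) → (Fin (N * δ) → Fin δ) → R)
    (T : (Fin (N * δ) → Fin N) → (Fin (N * δ) → Fin N) → (Fin (N * δ) → Fin N) → R)
    (α β : Fin (N * δ) → Fin δ) (u v : Fin (N * δ) → Fin N) :
    ∑ w : Fin (N * δ) → Fin N, permLegs₁ π U w α β * T u v w =
      ∑ w : Fin (N * δ) → Fin N, U w α β * permLegs₃ π⁻¹ T u v w := by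
  refine Fintype.sum_equiv (Equiv.arrowCongr π⁻¹ (Equiv.refl (Fin N))) _ _ fun w => ?_
  have h1 : (Equiv.arrowCongr π⁻¹ (Equiv.refl (Fin N))) w = w ∘ ⇑π := by
    funext k; simp [Equiv.arrowCongr_apply, Equiv.Perm.inv_def]
  have h2 : (w ∘ ⇑π) ∘ ⇑π⁻¹ = w := by
    funext k; simp
  rw [h1, permLegs₁_apply, permLegs₃_apply, h2]

/-- **Shared letter word, joint form.**  Permuting the letter legs of `X^{⊗Nδ}` by `π` inside the joint pairing of
`blowUp_det_eq_jointPairing` equals permuting the third legs of `t^{⊗Nδ}` by `π⁻¹`. [this node] -/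
theorem jointPairing_permLegs₁_eq_permLegs₃ (e : Fin (N * δ) ≃ Fin δ × Fin N) (π : Equiv.Perm (Fin (N * δ)))
    (X : Fin N → Matrix (Fin δ) (Fin δ) R) (t : Fin N → Fin N → Fin N → R) :
    (∑ σ : Equiv.Perm (Fin δ × Fin N), ((Equiv.Perm.sign σ : ℤ) : R) *
        ∑ w : Fin (N * δ) → Fin N,
          permLegs₁ π (kroneckerPow (fun l a b => X l a b) (N * δ)) w (fun k => (σ (e k)).1) (fun k => (e k).1) *
            kroneckerPow t (N * δ) (fun k => (σ (e k)).2) (fun k => (e k).2) w) =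
      ∑ σ : Equiv.Perm (Fin δ × Fin N), ((Equiv.Perm.sign σ : ℤ) : R) *
        ∑ w : Fin (N * δ) → Fin N,
          kroneckerPow (fun l a b => X l a b) (N * δ) w (fun k => (σ (e k)).1) (fun k => (e k).1) *
            permLegs₃ π⁻¹ (kroneckerPow t (N * δ)) (fun k => (σ (e k)).2) (fun k => (e k).2) w := by
  refine Finset.sum_congr rfl fun σ _ => ?_
  rw [sum_permLegs₁_mul_eq_sum_mul_permLegs₃]

end CommRing

/-! ### §3 The transfer: `ν` in the letters of `X` = `ν` in the third leg of `t` -/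

section Complex

variable {N δ : ℕ}

/-- **Self-adjointness of the character sum** (third leg): `⟪isotypicSum₃ ν T, K⟫ = ⟪T, isotypicSum₃ ν K⟫` — `χ_ν(π⁻¹) = χ_ν(π)`
and `w ↦ w∘π` is a bijection of words. [cite: ChristandlVranaZuiddam2023, §3.1] -/
theorem pairing_isotypicSum₃_comm {ι κ μ : Type*} [Fintype ι] [Fintype κ] [Fintype μ] [DecidableEq μ] {n : ℕ}
    (ν : Nat.Partition n) (T K : (Fin n → ι) → (Fin n → κ) → (Fin n → μ) → ℂ) :
    ∑ u, ∑ v, ∑ w, isotypicSum₃ ν T u v w * K u v w = ∑ u, ∑ v, ∑ w, T u v w * isotypicSum₃ ν K u v w := by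
  classical
  have hev : ∀ (F : (Fin n → ι) → (Fin n → κ) → (Fin n → μ) → ℂ) (u : Fin n → ι) (v : Fin n → κ)
      (w : Fin n → μ), isotypicSum₃ ν F u v w = ∑ π : Equiv.Perm (Fin n), spechtCharacter ℂ ν π * F u v (w ∘ ⇑π) := by
    intro F u v w
    simp only [isotypicSum₃, Finset.sum_apply, Pi.smul_apply, permLegs₃_apply, smul_eq_mul]
  simp_rw [hev, Finset.sum_mul, Finset.mul_sum]
  refine Finset.sum_congr rfl fun u _ => Finset.sum_congr rfl fun v _ => ?_
  rw [Finset.sum_comm]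
  conv_rhs => rw [Finset.sum_comm]
  rw [← Equiv.sum_comp (Equiv.inv (Equiv.Perm (Fin n)))]
  refine Finset.sum_congr rfl fun π _ => ?_
  simp only [Equiv.inv_apply, spechtCharacter_inv]
  refine Fintype.sum_equiv (Equiv.arrowCongr π (Equiv.refl μ)) _ _ fun w => ?_
  have h1 : (Equiv.arrowCongr π (Equiv.refl μ)) w = w ∘ ⇑π⁻¹ := by
    funext k; simp [Equiv.arrowCongr_apply, Equiv.Perm.inv_def]
  have h2 : (w ∘ ⇑π⁻¹) ∘ ⇑π = w := by
    funext k; simp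
  rw [h1, h2]
  ring

/-- **THE TRANSFER (`(D_t)_ν(X) = (D_X)_ν(t)`, NODE-g45 (T) at kernel level).**  For every `ν ⊢ Nδ` the `ν`-isotypic character sum
taken in the LETTER legs of `X^{⊗Nδ}` and the one taken in the THIRD legs of `t^{⊗Nδ}` give the same joint pairing. [this node] -/
theorem jointPairing_isotypicSum₁_eq_isotypicSum₃ (e : Fin (N * δ) ≃ Fin δ × Fin N) (ν : Nat.Partition (N * δ))
    (X : Fin N → Matrix (Fin δ) (Fin δ) ℂ) (t : Fin N → Fin N → Fin N → ℂ) :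
    (∑ σ : Equiv.Perm (Fin δ × Fin N), ((Equiv.Perm.sign σ : ℤ) : ℂ) *
        ∑ w : Fin (N * δ) → Fin N,
          isotypicSum₁ ν (kroneckerPow (fun l a b => X l a b) (N * δ)) w (fun k => (σ (e k)).1) (fun k => (e k).1) *
            kroneckerPow t (N * δ) (fun k => (σ (e k)).2) (fun k => (e k).2) w) =
      ∑ σ : Equiv.Perm (Fin δ × Fin N), ((Equiv.Perm.sign σ : ℤ) : ℂ) *
        ∑ w : Fin (N * δ) → Fin N,
          kroneckerPow (fun l a b => X l a b) (N * δ) w (fun k => (σ (e k)).1) (fun k => (e k).1) *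
            isotypicSum₃ ν (kroneckerPow t (N * δ)) (fun k => (σ (e k)).2) (fun k => (e k).2) w := by
  classical
  have hev₁ : ∀ (U : (Fin (N * δ) → Fin N) → (Fin (N * δ) → Fin δ) → (Fin (N * δ) → Fin δ) → ℂ)
      (w : Fin (N * δ) → Fin N) (α β : Fin (N * δ) → Fin δ),
      isotypicSum₁ ν U w α β = ∑ π : Equiv.Perm (Fin (N * δ)), spechtCharacter ℂ ν π * permLegs₁ π U w α β := by
    intro U w α β
    simp only [isotypicSum₁, Finset.sum_apply, Pi.smul_apply, smul_eq_mul]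
  have hev₃ : ∀ (T : (Fin (N * δ) → Fin N) → (Fin (N * δ) → Fin N) → (Fin (N * δ) → Fin N) → ℂ)
      (u v w : Fin (N * δ) → Fin N),
      isotypicSum₃ ν T u v w = ∑ π : Equiv.Perm (Fin (N * δ)), spechtCharacter ℂ ν π * permLegs₃ π T u v w := by
    intro T u v w
    simp only [isotypicSum₃, Finset.sum_apply, Pi.smul_apply, smul_eq_mul]
  -- both sides equal `Σ_π χ_ν(π) · J(π)` with `J(π)` the joint pairing twisted by `π ·₁` on the `X` side
  have hL : (∑ σ : Equiv.Perm (Fin δ × Fin N), ((Equiv.Perm.sign σ : ℤ) : ℂ) *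
        ∑ w : Fin (N * δ) → Fin N,
          isotypicSum₁ ν (kroneckerPow (fun l a b => X l a b) (N * δ)) w (fun k => (σ (e k)).1) (fun k => (e k).1) *
            kroneckerPow t (N * δ) (fun k => (σ (e k)).2) (fun k => (e k).2) w) =
      ∑ π : Equiv.Perm (Fin (N * δ)), spechtCharacter ℂ ν π *
        ∑ σ : Equiv.Perm (Fin δ × Fin N), ((Equiv.Perm.sign σ : ℤ) : ℂ) *
          ∑ w : Fin (N * δ) → Fin N,
            permLegs₁ π (kroneckerPow (fun l a b => X l a b) (N * δ)) w (fun k => (σ (e k)).1) (fun k => (e k).1) *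
              kroneckerPow t (N * δ) (fun k => (σ (e k)).2) (fun k => (e k).2) w := by
    simp_rw [hev₁, Finset.sum_mul, Finset.mul_sum]
    simp_rw [Finset.sum_comm (s := (Finset.univ : Finset (Fin (N * δ) → Fin N)))
      (t := (Finset.univ : Finset (Equiv.Perm (Fin (N * δ)))))]
    rw [Finset.sum_comm]
    refine Finset.sum_congr rfl fun π _ => Finset.sum_congr rfl fun σ _ => Finset.sum_congr rfl fun w _ => ?_
    ring
  have hR : (∑ σ : Equiv.Perm (Fin δ × Fin N), ((Equiv.Perm.sign σ : ℤ) : ℂ) *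
        ∑ w : Fin (N * δ) → Fin N,
          kroneckerPow (fun l a b => X l a b) (N * δ) w (fun k => (σ (e k)).1) (fun k => (e k).1) *
            isotypicSum₃ ν (kroneckerPow t (N * δ)) (fun k => (σ (e k)).2) (fun k => (e k).2) w) =
      ∑ π : Equiv.Perm (Fin (N * δ)), spechtCharacter ℂ ν π *
        ∑ σ : Equiv.Perm (Fin δ × Fin N), ((Equiv.Perm.sign σ : ℤ) : ℂ) *
          ∑ w : Fin (N * δ) → Fin N,
            kroneckerPow (fun l a b => X l a b) (N * δ) w (fun k => (σ (e k)).1) (fun k => (e k).1) *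
              permLegs₃ π (kroneckerPow t (N * δ)) (fun k => (σ (e k)).2) (fun k => (e k).2) w := by
    simp_rw [hev₃, Finset.mul_sum]
    simp_rw [Finset.sum_comm (s := (Finset.univ : Finset (Fin (N * δ) → Fin N)))
      (t := (Finset.univ : Finset (Equiv.Perm (Fin (N * δ)))))]
    rw [Finset.sum_comm]
    refine Finset.sum_congr rfl fun π _ => Finset.sum_congr rfl fun σ _ => Finset.sum_congr rfl fun w _ => ?_
    ring
  rw [hL, hR, ← Equiv.sum_comp (Equiv.inv (Equiv.Perm (Fin (N * δ))))]
  refine Finset.sum_congr rfl fun π _ => ?_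
  simp only [Equiv.inv_apply]
  rw [spechtCharacter_inv, jointPairing_permLegs₁_eq_permLegs₃, inv_inv]

/-- **The transfer, evaluation-functional form.**  The letter-`ν` part of `D_X(t)` equals THE PAIRING OF `t^{⊗Nδ}` WITH THE
`ν`-ISOTYPIC SUM OF THE EVALUATION FUNCTIONAL `K_X` of `blowUp_det_eq_pairing_evalKernel`:
`Σ_σ sgn σ Σ_w (isotypicSum₁ ν X^{⊗Nδ})(w,α_σ,β) t^{⊗Nδ}(u_σ,v,w) = Σ_{u,v,w} t^{⊗Nδ}(u,v,w) · (isotypicSum₃ ν K_X)(u,v,w)`. [this node] -/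
theorem letterIsotypic_eq_pairing_isotypicSum₃_evalKernel (e : Fin (N * δ) ≃ Fin δ × Fin N) (ν : Nat.Partition (N * δ))
    (X : Fin N → Matrix (Fin δ) (Fin δ) ℂ) (t : Fin N → Fin N → Fin N → ℂ) :
    (∑ σ : Equiv.Perm (Fin δ × Fin N), ((Equiv.Perm.sign σ : ℤ) : ℂ) *
        ∑ w : Fin (N * δ) → Fin N,
          isotypicSum₁ ν (kroneckerPow (fun l a b => X l a b) (N * δ)) w (fun k => (σ (e k)).1) (fun k => (e k).1) *
            kroneckerPow t (N * δ) (fun k => (σ (e k)).2) (fun k => (e k).2) w) =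
      ∑ u : Fin (N * δ) → Fin N, ∑ v : Fin (N * δ) → Fin N, ∑ w : Fin (N * δ) → Fin N,
        kroneckerPow t (N * δ) u v w *
          isotypicSum₃ ν (fun u v w => ∑ σ : Equiv.Perm (Fin δ × Fin N),
            (if (fun k => (σ (e k)).2) = u ∧ (fun k => (e k).2) = v then
              ((Equiv.Perm.sign σ : ℤ) : ℂ) *
                kroneckerPow (fun l a b => X l a b) (N * δ) w (fun k => (σ (e k)).1) (fun k => (e k).1)
            else 0)) u v w := by
  classical
  rw [jointPairing_isotypicSum₁_eq_isotypicSum₃, jointPairing_eq_pairing_evalKernel, pairing_isotypicSum₃_comm]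

/-! ### §4 The cheap half of the upper direction: letter-`ν` part `≠ 0` ⟹ `ν` occurs in the third-leg marginal -/

/-- **Letter-`ν` part of `D_X(t)` non-zero ⟹ `isotypicSum₃ ν (t^{⊗Nδ}) ≠ 0`** (the third-leg marginal of `t^{⊗Nδ}` meets the type
`ν`).  The upgrade to the triple `((δ^N),(δ^N),ν)` is the remaining debt described in the module docstring. [this node] -/
theorem isotypicSum₃_kroneckerPow_ne_zero_of_letterIsotypic_ne_zero (e : Fin (N * δ) ≃ Fin δ × Fin N)
    (ν : Nat.Partition (N * δ)) (X : Fin N → Matrix (Fin δ) (Fin δ) ℂ) (t : Fin N → Fin N → Fin N → ℂ)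
    (h : (∑ σ : Equiv.Perm (Fin δ × Fin N), ((Equiv.Perm.sign σ : ℤ) : ℂ) *
        ∑ w : Fin (N * δ) → Fin N,
          isotypicSum₁ ν (kroneckerPow (fun l a b => X l a b) (N * δ)) w (fun k => (σ (e k)).1) (fun k => (e k).1) *
            kroneckerPow t (N * δ) (fun k => (σ (e k)).2) (fun k => (e k).2) w) ≠ 0) :
    isotypicSum₃ ν (kroneckerPow t (N * δ)) ≠ 0 := by
  intro h0
  apply h
  rw [jointPairing_isotypicSum₁_eq_isotypicSum₃, h0]
  simp

end Complex


end Summit.MatrixMultiplication.MatrixMultiplication.Theorems.ObstructionDescentBlowUpDuality
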